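import Summits.QuantumFields.YangMills.Theorems.ChatterjeeMassGapTorusAxialFreeLink
import HarnessLib

/-!
# S28ᵀ (Chatterjee torus-axial mass gap) — one-link resampling under `dg_∞` (ym-idea-4 g6, LINE-11b)

Companion of `S28FreeLink` (LINE-11). From the shear invariance of the infinite product Haar
measure `dg_∞ = zdHaar d G` (`S28FreeLink.measurePreserving_shear`) and Fubini:

* `integral_eq_integral_integral_shear` — `∫ F dg_∞ = ∫ (∫_G F(U with U_ℓ ↦ U_ℓ·g) dg) dg_∞(U)`;
* `integral_eq_integral_integral_update` — **one-link resampling**: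
  `∫ F dg_∞ = ∫ (∫_G F(U with U_ℓ ↦ g) dg) dg_∞(U)` for every continuous `F` and every link `ℓ`
  (the heat-bath / DLR identity of the free measure at one link);
* `integral_mul_eq_integral_integral_update_mul` — with a spectator: if `Y` does not depend on the
  link `ℓ`, `∫ X·Y dg_∞ = ∫ (∫_G X(U with U_ℓ ↦ g) dg)·Y(U) dg_∞(U)`.

Use (bears on rung S28ᵀ through the fork `S28BoxBit.gapCore_eventually_of_boxCumulant`): in the
(O2) evaluation of the box integral `κ_□` and in the (O1) cumulant-locality proof, a link shared
by TWO faces is integrated out first — the inner Haar integral is then a one-variable integral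
`∫_G Re χ(A g B) Re χ(C g⁻¹ D) dg` (MERGE,
`GaugeBoot.DiagRPSUN.integral_re_trace_mul_inv_mul_of_two`
/ `_of_three_le`) or `∫_G χ(A g B g⁻¹) dg` (SPLIT, `DiagRPSUN.integral_trace_conj_mul`), with the
remaining faces as the spectator `Y`. Blueprint: pub/ideators/ym-idea-4/bc/g6/O1O2-PLAN.md.
No summit is proved here: Haar-measure glue for the island (small-β) case of the S28ᵀ gap core only.
-/

noncomputable section

open MeasureTheory Filter Topology
open Literature.MathematicalPhysics.QuantumLattice
open Literature.MathematicalPhysics.QuantumFieldTheory (zdHaar haarProbability)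
open Literature.Probability.LatticeModels (Site)

namespace Summit.QuantumFields.YangMills.Theorems.S28FreeLinkResample

open S28FreeLink

variable {G : Type} [Group G] [TopologicalSpace G] [IsTopologicalGroup G]
  [CompactSpace G] [MeasurableSpace G] [BorelSpace G] [SecondCountableTopology G]
variable {d : ℕ}

omit [TopologicalSpace G] [IsTopologicalGroup G] [CompactSpace G] [MeasurableSpace G]
  [BorelSpace G] [SecondCountableTopology G] in
/-- The shear by `g` is the update of the link `ℓ` to `U_ℓ·g`. [folklore] -/
theorem shear_eq_update (ℓ : ZdEdge d) (U : LGConfig d G) (g : G) :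
    (fun e' : ZdEdge d => if e' = ℓ then U e' * g else U e') = Function.update U ℓ (U ℓ * g) := by
  funext e'
  by_cases h : e' = ℓ
  · subst h
    simp
  · rw [if_neg h, Function.update_of_ne h]

/-- **Averaging over the shear.** For continuous `F`,
`∫ F dg_∞ = ∫ (∫_G F(U with U_ℓ ↦ U_ℓ·g) dg) dg_∞(U)` (shear invariance of `dg_∞` for each `g`,
then the `g`-average is an average of a constant, then Fubini). [folklore] -/
theorem integral_eq_integral_integral_shear (ℓ : ZdEdge d) {F : LGConfig d G → ℝ}
    (hF : Continuous F) :
    ∫ U, F U ∂zdHaar d G =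
      ∫ U, ∫ g, F (fun e' : ZdEdge d => if e' = ℓ then U e' * g else U e') ∂haarProbability G
        ∂zdHaar d G := by
  set π : Measure (LGConfig d G) := zdHaar d G
  obtain ⟨C, hC⟩ := isCompact_univ.exists_bound_of_continuousOn hF.continuousOn
  have step1 : ∀ g : G,
      ∫ U, F U ∂π = ∫ U, F (fun e' : ZdEdge d => if e' = ℓ then U e' * g else U e') ∂π := by
    intro g
    have hΦ := measurePreserving_shear (d := d) (G := G) ℓ g
    have key := integral_map (μ := π) hΦ.measurable.aemeasurable (f := F) hF.aestronglyMeasurable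
    rw [hΦ.map_eq] at key
    exact key
  have hconst : ∫ U, F U ∂π =
      ∫ g, ∫ U, F (fun e' : ZdEdge d => if e' = ℓ then U e' * g else U e') ∂π
        ∂haarProbability G := by
    have : (fun g : G => ∫ U, F (fun e' : ZdEdge d => if e' = ℓ then U e' * g else U e') ∂π) =
        fun _ => ∫ U, F U ∂π := funext fun g => (step1 g).symm
    rw [this, integral_const, probReal_univ, one_smul]
  -- Fubini
  have hsh : Continuous fun p : G × LGConfig d G =>
      (fun e' : ZdEdge d => if e' = ℓ then p.2 e' * p.1 else p.2 e') := by
    refine continuous_pi fun e' => ?_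
    by_cases h : e' = ℓ
    · simp only [h, if_true]
      exact ((continuous_apply ℓ).comp continuous_snd).mul continuous_fst
    · simp only [h, if_false]
      exact (continuous_apply e').comp continuous_snd
  have hH : Continuous fun p : G × LGConfig d G =>
      F (fun e' : ZdEdge d => if e' = ℓ then p.2 e' * p.1 else p.2 e') := hF.comp hsh
  have hint : Integrable (fun p : G × LGConfig d G =>
      F (fun e' : ZdEdge d => if e' = ℓ then p.2 e' * p.1 else p.2 e'))
      ((haarProbability G).prod π) :=
    (integrable_const C).mono' hH.aestronglyMeasurable
      (Eventually.of_forall fun p => by simpa using hC _ (Set.mem_univ _))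
  rw [hconst, integral_integral_swap (f := fun (g : G) (U : LGConfig d G) =>
    F (fun e' : ZdEdge d => if e' = ℓ then U e' * g else U e')) hint]

/-- **One-link resampling (heat bath of the free measure).** For continuous `F` and any link `ℓ`,
`∫ F dg_∞ = ∫ (∫_G F(U with U_ℓ ↦ g) dg) dg_∞(U)`: the shear average of
`integral_eq_integral_integral_shear` becomes a fresh Haar variable by left invariance of Haar
measure (`∫_G F(…U_ℓ·g…) dg = ∫_G F(…g…) dg`). [folklore] -/
theorem integral_eq_integral_integral_update (ℓ : ZdEdge d) {F : LGConfig d G → ℝ}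
    (hF : Continuous F) :
    ∫ U, F U ∂zdHaar d G =
      ∫ U, ∫ g, F (Function.update U ℓ g) ∂haarProbability G ∂zdHaar d G := by
  rw [integral_eq_integral_integral_shear ℓ hF]
  refine integral_congr_ae (Eventually.of_forall fun U => ?_)
  beta_reduce
  simp_rw [shear_eq_update ℓ U]
  exact integral_mul_left_eq_self (μ := haarProbability G)
    (fun g => F (Function.update U ℓ g)) (U ℓ)

omit [Group G] [TopologicalSpace G] [IsTopologicalGroup G] [CompactSpace G] [MeasurableSpace G]
  [BorelSpace G] [SecondCountableTopology G] in
/-- An observable depending only on links in `S ∌ ℓ` does not feel an update of `ℓ`. [folklore] -/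
theorem update_invariant_of_dependsOn {β : Type*} {Y : LGConfig d G → β} {S : Set (ZdEdge d)}
    (hY : DependsOn Y S) {ℓ : ZdEdge d} (hℓ : ℓ ∉ S) (U : LGConfig d G) (g : G) :
    Y (Function.update U ℓ g) = Y U :=
  hY fun _ he => Function.update_of_ne (ne_of_mem_of_not_mem he hℓ) _ _

/-- **One-link resampling with a spectator.** If the continuous `Y` does not feel the link `ℓ`,
`∫ X·Y dg_∞ = ∫ (∫_G X(U with U_ℓ ↦ g) dg)·Y(U) dg_∞(U)`; the inner integral is where a one-link
Haar identity (MERGE / SPLIT / absorption) is applied, the other faces riding along in `Y`.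
[folklore] -/
theorem integral_mul_eq_integral_integral_update_mul (ℓ : ZdEdge d) {X Y : LGConfig d G → ℝ}
    (hX : Continuous X) (hYc : Continuous Y)
    (hY : ∀ (U : LGConfig d G) (g : G), Y (Function.update U ℓ g) = Y U) :
    ∫ U, X U * Y U ∂zdHaar d G =
      ∫ U, (∫ g, X (Function.update U ℓ g) ∂haarProbability G) * Y U ∂zdHaar d G := by
  rw [integral_eq_integral_integral_update ℓ (F := fun U => X U * Y U) (hX.mul hYc)]
  refine integral_congr_ae (Eventually.of_forall fun U => ?_)
  beta_reduce
  simp_rw [hY U]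
  exact integral_mul_const _ _

end Summit.QuantumFields.YangMills.Theorems.S28FreeLinkResample
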